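import Summits.BirchSwinnertonDyer.BirchSwinnertonDyer.Theorems.AdditiveKolyvaginRoadKolyvaginPrimitiveOfLowerHalvesOverQ
import HarnessLib

/-!
# Route `AdditiveKolyvaginRoad`: the Kolyvagin cruxes KPA′ (`KolyvaginPrimitiveAdditive`, item stmt-BirchSwinnertonDyer-21400) and
# KS′ (`LevelKolyvaginSystemsAdditive`, item stmt-BirchSwinnertonDyer-21396) are TIGHT — EQUIVALENT, modulo the antecedents the
# route's kernel and `closes` already carry, to `BSD_p` on the ♯ additive rank-one rows
# (cell `pub/bsd-wall`, width seat `bsd-wall-akr-p2x-w2` g8; `--supports stmt-BirchSwinnertonDyer-21396`, helper)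

THEOREMS ONLY (no definition, no named fact, no `sorry`); nothing about Kolyvagin's conjecture and nothing about `BSD(E,p)` is
asserted — every `p`-part of BSD, every published input and every duality input below is a HYPOTHESIS.  BSD is not proved by any
of this; KPA′ and KS′ stay OPEN at `p² ∣ N`.

THE POINT (the loop closed, by name).  The route's kernel `AdditiveKolyvaginKernel` (item 20138, LANDED
`AdditiveKolyvaginKernel.additiveKolyvaginKernel_proof`) reads the crux chain FORWARD:
`PublishedInputsAdditiveKoly → ManinGoodOddFrameAdditive → KolyvaginPrimitiveAdditive → RankZeroAdditive → (BSDp W p at every ♯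
additive rank-one row)`.  Width seat akr-p2x-w5 g6's `kolyvaginPrimitiveAdditive_of_lowerHalves` (p638284) reads it BACKWARD from
the LOWER halves of `BSD_p` over `ℚ` (`Typed.MissingLowerBoundAt` on the non-CM additive rank-zero rows and on the ♯ additive
rank-one rows), modulo PUB and McCallum's Cor. 5.6 (divisibility half).  This file states the consequence in the ROUTE'S OWN
DECLS, as akr-p3 g0's `bottomRankOneAdditive_of_rankZeroAdditive_of_sharpRankOne` did for the bottom crux BOT′ only:

* §0 `indexLowerBoundAt_of_lowerHalves` — the STEP-L-shaped socket that p638284 keeps inside a proof, as a decl and at ANY odd prime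
  `p ∣ N_E` (additive OR multiplicative): for `W/ℚ` globally minimal with `ord_{s=1} L(E,s) = 1`, a Heegner field `K` with `d_K` odd
  and `L(E^{(d_K)},1) ≠ 0`, a datum with `p ∤ c(Dt)`: the lower half `Typed.MissingLowerBoundAt W p` and the lower half for every
  globally minimal model of the twist give `X11b.IndexLowerBoundAt W p K P` (`2·ord_p [E(K):ℤP] ≤ ord_p #Ш(E/K) + 2·ord_p ∏ c_ℓ`) at
  every Heegner point `P` of the datum — multr1-p2's `X11b.indexLowerBoundAt_of_missingLowerBoundAt` with its side conditions
  (`Wd` minimal, `ord_p u(Cd) = 0`, `ord_p ∏c(Wd) = ord_p ∏c(W)`, the twist's print-shape half) DISCHARGED because `p ∣ N` splits in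
  `K`.  This is the input shape `hL`/`hILB` of `bdp_rebase` S5, of `kolyvaginPrimitiveAdditive_of_indexLowerBound` and of X11b's descent.
* §1 `kolyvaginPrimitiveAdditive_of_rankZeroAdditive_of_sharpRankOne` —
  `PUB → McCallum (div. half) → RankZeroAdditive → (the kernel's conclusion «∀ ♯ additive rank-one rows, BSDp W p», VERBATIM) →
  KolyvaginPrimitiveAdditive`: each `BSDp` contains its lower half (`Typed.missingPPartAt_of_bsdp`, `Ш` finite by GZK in analytic
  rank `≤ 1`), and p638284 needs nothing more.  `levelKolyvaginSystemsAdditive_of_rankZeroAdditive_of_sharpRankOne` — the same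
  for KS′ through akr-p2x-w4 g2's input-free door `levelKolyvaginSystemsAdditive_of_kolyvaginPrimitiveAdditive_free` (p635192).
* §2 `kolyvaginPrimitiveAdditive_iff_sharpRankOne` — granted PUB, McCallum's divisibility half, the Manin-good odd frame
  `ManinGoodOddFrameAdditive` and the rank-zero residual `RankZeroAdditive` (all four antecedents of the kernel ∕ of `closes`):
  **`KolyvaginPrimitiveAdditive ↔ (∀ ♯ additive rank-one rows, BSDp W p)`** ((→) = the landed kernel, (←) = §1).
  `levelKolyvaginSystemsAdditive_iff_sharpRankOne` — the same for THIS crux KS′, with the levelwise Cassels–Tate inputs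
  `casselsTate_levelInputs` added on the (→) side (KS′ → KPA′ is akr-p2x-w4 g2's `kolyvaginPrimitiveAdditive_of_casselsTate_of_levelSystems`,
  Zhang's induction: parity needs Cassels–Tate).
READING (kernel-checked, route level): modulo {PUB, McCallum Cor. 5.6, Manin frame, `RankZeroAdditive`} (+ Cassels–Tate for KS′),
Kolyvagin's conjecture mod `p` on the ♯ additive frames — items 21400 and 21396 — is EXACTLY Miller's `BSD(E,p)` on the ♯ additive
rank-one rows at `p ≥ 5`, neither more nor less: a disproof of either crux on a ♯ frame would be a disproof of `BSD_p` at a ♯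
additive rank-one row or at a non-CM additive rank-zero row, and any proof of `BSD_p` there (by whatever engine, with no Heegner
point, level system or `p²`-level multiplicity one) closes both items mechanically.  CONDITIONAL on every antecedent; nothing booked.

References (locators only): [cite: WZhang2014, Thm. 1.1, Remark 5 and Thm. 10.2] [cite: McCallumLMS1991, §5 Cor. 5.6 (p. 310)]
[cite: JetchevSkinnerWan2017, §7.4.1–7.4.3 (pp. 30–31)] [cite: GrossZagier1986, V.§2 (2.2)] [cite: Miller2011LMS, Def. 1.1]
[cite: MilneADT2006, I Thm. 4.10 and Thm. 6.13].
-/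

-- single-conjunct summit: `Summit.BirchSwinnertonDyer.BirchSwinnertonDyer.…` repeats the name by design
set_option linter.dupNamespace false

set_option autoImplicit false

noncomputable section

open scoped Classical

namespace Summit.BirchSwinnertonDyer.BirchSwinnertonDyer.Theorems.AdditiveKoly

open WeierstrassCurve NumberField Field
  Literature.NumberTheory.EllipticCurves Literature.NumberTheory.EllipticCurves.ModularForms
  Literature.NumberTheory.EllipticCurves.Rank1Residual
  Summit.BirchSwinnertonDyer.Rank1Residual Summit.BirchSwinnertonDyer.Rank1Residual.X11b
  Summit.BirchSwinnertonDyer.Rank1Residual.X11b.Three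
  Summit.BirchSwinnertonDyer.BirchSwinnertonDyer.Theses.AdditiveKolyvaginRoad

/-! ## §0 STEP L at a Heegner datum from the two lower halves over `ℚ`, at any odd `p ∣ N` -/

section Frame

-- `K : Type`: the tree's ring-class class field theory is universe `0` (as in the cruxes).
variable (W : WeierstrassCurve ℚ) [W.IsElliptic] [W.IsGloballyMinimal] [NeZero (W.conductorNorm ℤ)]
  (p : ℕ) [hp : Fact p.Prime] (K : Type) [Field K] [NumberField K]
  (Dt : ModularParametrizationData W (W.conductorNorm ℤ)) (H : HeegnerDatum (W.conductorNorm ℤ) (NumberField.discr K))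
  (ι : K →+* ℂ) (P : (W.baseChange K).toAffine.Point)

/-- **STEP L AT A HEEGNER POINT FROM THE TWO LOWER HALVES OVER `ℚ`, at any odd prime `p ∣ N_E`.**  Data: `W/ℚ` globally
minimal elliptic with `ord_{s=1} L(E,s) = 1`; an odd prime `p` dividing the conductor (additive or multiplicative); `K` imaginary
quadratic with `d_K` odd, the Heegner hypothesis for `N_E` and `L(E^{(d_K)},1) ≠ 0`; a parametrisation datum `Dt` of level `N_E`
with `p ∤ c(Dt)`, a Heegner datum `H` and a point `P ∈ E(K)` over `heegnerPointComplex Dt H`.  PUBLISHED inputs as binders: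
Gross–Zagier `hGZ`, Kolyvagin `hKo`, GZK `hGZK`, modularity `hmod`.  HYPOTHESES (the W-ALL currency over `ℚ`): the lower half of
`BSD(E,p)` (`hlow : Typed.MissingLowerBoundAt W p`, `ord_p #Ш(E)_an ≤ ord_p #Ш(E)`) and the lower half for EVERY globally minimal
model `Wd = Cd • E^{(d_K)}` of the twist (`hlowTw`).  CONCLUSION: `X11b.IndexLowerBoundAt W p K P`.  Proof: a globally minimal model
of the twist exists (Néron) and has `L(Wd,1) ≠ 0`, so its lower half is the `≤`-half of `L(Wd,1)/Ω` (`twist_ge_half_of_missingLowerBoundAt`);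
`p ∣ N_E` splits in `K`, whence `p ∤ d_K`, `p ∤ #𝓞_K^×`, `ord_p ∏c(Wd) = ord_p ∏c(W)` (`X2.padicValNat_tamagawaProduct_twist_of_heegner_of_odd`)
and `ord_p u(Cd) = 0` (`X11b.padicValRat_u_eq_zero_of_twist_minimal_of_splitsIn`); then multr1-p2's Gross–Zagier bookkeeping
`X11b.indexLowerBoundAt_of_missingLowerBoundAt` (Jetchev–Skinner–Wan §7.4.1 read backwards).  The composition inside akr-p2x-w5 g6's
`exists_kolyvaginClass_ne_zero_of_lowerHalves` (p638284), exposed in STEP-L shape and without the additive ∕ `p ≥ 5` ∕ `ρ̄` binders.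
CONDITIONAL on every binder; nothing is booked. [cite: JetchevSkinnerWan2017, §7.4.1 (eq:gz), (eq:shalowerK-1), (eq:tamK), pp. 30–31]
[cite: GrossZagier1986, V.§2 (2.2)] [cite: Miller2011LMS, Def. 1.1] -/
theorem indexLowerBoundAt_of_lowerHalves
    -- published inputs (named facts of the tree)
    (hGZ : gross_zagier (W.conductorNorm ℤ) W K) (hKo : kolyvagin (W.conductorNorm ℤ) W K)
    (hGZK : rank_eq_analyticRank_of_analyticRank_le_one) (hmod : hasEntireLFunction_rat)
    -- the datum (only the binders that are used)
    (hp2 : p ≠ 2) (hpN : p ∣ W.conductorNorm ℤ) (hr : W.analyticRank = 1)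
    (hK : IsImaginaryQuadratic K) (hodd : Odd (NumberField.discr K))
    (hH : SatisfiesHeegnerHypothesis (W.conductorNorm ℤ) K)
    (hL : (W.quadraticTwist (NumberField.discr K : ℚ)).entireLFunction 1 ≠ 0) (hc : ¬ (p : ℤ) ∣ Dt.c)
    (hP : WeierstrassCurve.Affine.Point.map ι.toRatAlgHom P = heegnerPointComplex Dt H)
    -- the lower halves over `ℚ`: for `E` (analytic rank 1) and for the minimal models of the twist `E^{(d_K)}` (rank 0)
    (hlow : Typed.MissingLowerBoundAt W p)
    (hlowTw : ∀ (Wd : WeierstrassCurve ℚ) [Wd.IsElliptic] [Wd.IsGloballyMinimal] (Cd : VariableChange ℚ),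
      Cd • W.quadraticTwist (NumberField.discr K : ℚ) = Wd → Typed.MissingLowerBoundAt Wd p) :
    IndexLowerBoundAt W p K P := by
  have hpP : p.Prime := hp.out
  -- `p ∣ N` splits in `K`: `p ∤ d_K`, `p ∤ #𝓞_K^×`
  have hpd : ¬ (p : ℤ) ∣ NumberField.discr K :=
    Literature.SatisfiesHeegnerHypothesis.not_dvd_discr hK.1 hH hpP hpN
  obtain ⟨-, hμ⟩ := not_dvd_discr_and_not_dvd_torsionOrder_of_heegner hK hH hp2 hpN
  -- a globally minimal model `Wd` of the twist `E^{(d_K)}` (Néron): `L(Wd,1) ≠ 0`, its lower half in the `≤`-shape of `L/Ω`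
  have hD0 : (NumberField.discr K : ℚ) ≠ 0 := by exact_mod_cast NumberField.discr_ne_zero K
  haveI hEt : (W.quadraticTwist (NumberField.discr K : ℚ)).IsElliptic := W.isElliptic_quadraticTwist hD0
  obtain ⟨Cd, hCd⟩ := hasGlobalMinimalModel_rat_holds (W.quadraticTwist (NumberField.discr K : ℚ))
  haveI := hCd
  set Wd : WeierstrassCurve ℚ := Cd • W.quadraticTwist (NumberField.discr K : ℚ) with hWd_def
  have hWd : Cd • W.quadraticTwist (NumberField.discr K : ℚ) = Wd := rfl
  have hLt' : (W.quadraticTwist (NumberField.discr K : ℚ)).entireLFunction = Wd.entireLFunction := by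
    rw [← hWd, entireLFunction_smul]
  have hLd1 : Wd.entireLFunction 1 ≠ 0 := by rw [← hLt']; exact hL
  obtain ⟨qd, hqd, hvqd⟩ :=
    AdditiveBranchIMCGordTwoRankOne.HeegnerKolyvagin.twist_ge_half_of_missingLowerBoundAt hGZK hmod Wd p hLd1
      (hlowTw Wd Cd hWd)
  -- the two side conditions of multr1-p2's bookkeeping, discharged at a Heegner field
  have htamEq : padicValNat p Wd.tamagawaProduct = padicValNat p W.tamagawaProduct :=
    X2.padicValNat_tamagawaProduct_twist_of_heegner_of_odd W p hp2 K hK hodd hpd hH Cd hWd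
  have hu : padicValRat p (Cd.u : ℚ) = 0 :=
    X11b.padicValRat_u_eq_zero_of_twist_minimal_of_splitsIn W p K hK.1 (hH p hpP hpN) Cd hWd
  -- Jetchev–Skinner–Wan §7.4.1 read backwards over `K`
  exact indexLowerBoundAt_of_missingLowerBoundAt W p (W.conductorNorm ℤ) K Dt H ι P hGZ hKo hGZK hmod hK hH hP
    hp2 hc hμ hr hL Wd Cd hWd hu htamEq ⟨qd, hqd, hvqd⟩ hlow

end Frame

/-! ## §1 KPA′ and KS′ from `RankZeroAdditive` and the kernel's conclusion -/

/-- **`KolyvaginPrimitiveAdditive ⟸ PUB ∧ McCallum (div. half) ∧ RankZeroAdditive ∧ (the kernel's conclusion)`.**  Granted the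
route's published-inputs conjunction `PublishedInputsAdditiveKoly` (only Gross–Zagier, Kolyvagin, Kolyvagin's bound, GZK and
modularity are used) and McCallum's Cor. 5.6 divisibility half (named fact
`McCallum1991_padicValNat_card_sha_primary_add_le_of_globalDivisibility`): the rank-zero residual `RankZeroAdditive` (`BSD_p` at
every non-CM additive rank-zero row, `p ≥ 5`) together with «`BSDp W p` at every ♯ additive rank-one row» — VERBATIM the
conclusion of the route's kernel `Theses.AdditiveKolyvaginRoad.AdditiveKolyvaginKernel` — gives crux r2 `KolyvaginPrimitiveAdditive`
(item stmt-BirchSwinnertonDyer-21400): each `BSDp` yields its lower half `Typed.MissingLowerBoundAt` (`Typed.missingPPartAt_of_bsdp`,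
`Ш(E)` finite by GZK in analytic rank `≤ 1`), and akr-p2x-w5 g6's `kolyvaginPrimitiveAdditive_of_lowerHalves` consumes exactly
the two lower halves.  So, modulo antecedents the kernel also carries, crux r2 has NO SURPLUS over what the kernel proves from it.
CONDITIONAL on every antecedent; nothing is booked. [cite: WZhang2014, Remark 5 and Thm. 10.2] [cite: Miller2011LMS, Def. 1.1]
[cite: McCallumLMS1991, §5 Cor. 5.6 (p. 310)] -/
theorem kolyvaginPrimitiveAdditive_of_rankZeroAdditive_of_sharpRankOne (hPub : PublishedInputsAdditiveKoly)
    (hMc : McCallum1991_padicValNat_card_sha_primary_add_le_of_globalDivisibility) (h₀ : RankZeroAdditive)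
    (hsharp : ∀ (W : WeierstrassCurve ℚ) [W.IsElliptic] [W.IsGloballyMinimal] (p : ℕ) [Fact p.Prime],
      ¬ W.HasCM → 5 ≤ p → Addv W p → W.analyticRank = 1 → W.HasSurjectiveModNGaloisRep p →
      (∀ (ℓ : ℕ) [Fact ℓ.Prime], W.HasMultiplicativeReductionAtPrime ℓ →
        ¬ p ∣ padicValInt ℓ W.minimalDiscriminantInt) →
      (∃ (ℓ₁ ℓ₂ : ℕ) (_ : Fact ℓ₁.Prime) (_ : Fact ℓ₂.Prime), ℓ₁ ≠ ℓ₂ ∧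
        W.HasMultiplicativeReductionAtPrime ℓ₁ ∧ W.HasMultiplicativeReductionAtPrime ℓ₂) →
      ¬ p ∣ W.tamagawaProduct → BSDp W p) :
    KolyvaginPrimitiveAdditive := by
  have hGZK : rank_eq_analyticRank_of_analyticRank_le_one := hPub.2.2.2.1
  refine kolyvaginPrimitiveAdditive_of_lowerHalves hPub hMc ?_ ?_
  · -- the lower half at every non-CM additive rank-zero row, from `RankZeroAdditive`
    intro W _ _ p _ hCM hp5 hadd hr0
    haveI : Finite W.sha := (hGZK W (by omega)).2
    exact (Typed.lower_and_upper_of_missingPPartAt W p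
      (Typed.missingPPartAt_of_bsdp W p (h₀ W p hCM hp5 hadd hr0))).1
  · -- the lower half at every ♯ additive rank-one row, from the kernel's conclusion
    intro W _ _ p _ hCM hp5 hadd hr hs hsp htwo htam
    haveI : Finite W.sha := (hGZK W (le_of_eq hr)).2
    exact (Typed.lower_and_upper_of_missingPPartAt W p
      (Typed.missingPPartAt_of_bsdp W p (hsharp W p hCM hp5 hadd hr hs hsp htwo htam))).1

/-- **`LevelKolyvaginSystemsAdditive ⟸ PUB ∧ McCallum (div. half) ∧ RankZeroAdditive ∧ (the kernel's conclusion)`** — §1 for THIS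
crux KS′ (item stmt-BirchSwinnertonDyer-21396), through akr-p2x-w4 g2's input-free door
`levelKolyvaginSystemsAdditive_of_kolyvaginPrimitiveAdditive_free` (KPA′ → KS′ at the Poitou–Tate THEOREM, p635192 ∕ p624636).
CONDITIONAL on every antecedent; nothing is booked. [cite: WZhang2014, Thm. 1.1 and §9] [cite: MilneADT2006, I Thm. 4.10]
[cite: Miller2011LMS, Def. 1.1] -/
theorem levelKolyvaginSystemsAdditive_of_rankZeroAdditive_of_sharpRankOne (hPub : PublishedInputsAdditiveKoly)
    (hMc : McCallum1991_padicValNat_card_sha_primary_add_le_of_globalDivisibility) (h₀ : RankZeroAdditive)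
    (hsharp : ∀ (W : WeierstrassCurve ℚ) [W.IsElliptic] [W.IsGloballyMinimal] (p : ℕ) [Fact p.Prime],
      ¬ W.HasCM → 5 ≤ p → Addv W p → W.analyticRank = 1 → W.HasSurjectiveModNGaloisRep p →
      (∀ (ℓ : ℕ) [Fact ℓ.Prime], W.HasMultiplicativeReductionAtPrime ℓ →
        ¬ p ∣ padicValInt ℓ W.minimalDiscriminantInt) →
      (∃ (ℓ₁ ℓ₂ : ℕ) (_ : Fact ℓ₁.Prime) (_ : Fact ℓ₂.Prime), ℓ₁ ≠ ℓ₂ ∧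
        W.HasMultiplicativeReductionAtPrime ℓ₁ ∧ W.HasMultiplicativeReductionAtPrime ℓ₂) →
      ¬ p ∣ W.tamagawaProduct → BSDp W p) :
    LevelKolyvaginSystemsAdditive :=
  levelKolyvaginSystemsAdditive_of_kolyvaginPrimitiveAdditive_free
    (kolyvaginPrimitiveAdditive_of_rankZeroAdditive_of_sharpRankOne hPub hMc h₀ hsharp)

/-! ## §2 The loop closed with the landed kernel: KPA′ and KS′ are EQUIVALENT to `BSD_p` on the ♯ additive rank-one rows -/

/-- **CRUX r2 IS TIGHT: `KolyvaginPrimitiveAdditive ↔ (∀ ♯ additive rank-one rows, BSDp W p)`, modulo the kernel's own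
antecedents.**  Granted the published inputs (PUB), McCallum's Cor. 5.6 divisibility half, the Manin-good odd frame
`ManinGoodOddFrameAdditive` and the rank-zero residual `RankZeroAdditive` — all four also antecedents of the route's kernel ∕ `closes`
—: (→) is the LANDED kernel `AdditiveKolyvaginKernel.additiveKolyvaginKernel_proof` (item 20138); (←) is §1 (akr-p2x-w5 g6's lower-halves
socket p638284).  Reading: Kolyvagin's conjecture mod `p` on the ♯ additive frames (item 21400) is EXACTLY Miller's `BSD(E,p)` on the ♯
additive rank-one rows at `p ≥ 5` once the rank-zero additive residual is granted — neither more nor less.  CONDITIONAL on every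
antecedent; nothing is booked; BSD is not proved by this. [cite: WZhang2014, Thm. 1.1 and Thm. 10.2] [cite: McCallumLMS1991, §5 Cor. 5.6]
[cite: JetchevSkinnerWan2017, §7.4.1–7.4.3] [cite: Miller2011LMS, Def. 1.1] -/
theorem kolyvaginPrimitiveAdditive_iff_sharpRankOne (hPub : PublishedInputsAdditiveKoly)
    (hMc : McCallum1991_padicValNat_card_sha_primary_add_le_of_globalDivisibility)
    (hM : ManinGoodOddFrameAdditive) (h₀ : RankZeroAdditive) :
    KolyvaginPrimitiveAdditive ↔
      ∀ (W : WeierstrassCurve ℚ) [W.IsElliptic] [W.IsGloballyMinimal] (p : ℕ) [Fact p.Prime],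
        ¬ W.HasCM → 5 ≤ p → Addv W p → W.analyticRank = 1 → W.HasSurjectiveModNGaloisRep p →
        (∀ (ℓ : ℕ) [Fact ℓ.Prime], W.HasMultiplicativeReductionAtPrime ℓ →
          ¬ p ∣ padicValInt ℓ W.minimalDiscriminantInt) →
        (∃ (ℓ₁ ℓ₂ : ℕ) (_ : Fact ℓ₁.Prime) (_ : Fact ℓ₂.Prime), ℓ₁ ≠ ℓ₂ ∧
          W.HasMultiplicativeReductionAtPrime ℓ₁ ∧ W.HasMultiplicativeReductionAtPrime ℓ₂) →
        ¬ p ∣ W.tamagawaProduct → BSDp W p :=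
  ⟨fun h₁ ↦ AdditiveKolyvaginKernel.additiveKolyvaginKernel_proof hPub hM h₁ h₀,
    kolyvaginPrimitiveAdditive_of_rankZeroAdditive_of_sharpRankOne hPub hMc h₀⟩

/-- **CRUX KS′ IS TIGHT: `LevelKolyvaginSystemsAdditive ↔ (∀ ♯ additive rank-one rows, BSDp W p)`, modulo the kernel's
antecedents and the levelwise Cassels–Tate inputs.**  As `kolyvaginPrimitiveAdditive_iff_sharpRankOne`, for THIS crux (item
stmt-BirchSwinnertonDyer-21396): (→) is KS′ → KPA′ (akr-p2x-w4 g2's `kolyvaginPrimitiveAdditive_of_casselsTate_of_levelSystems`: Zhang's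
induction along the level systems, whose parity step needs the levelwise Cassels–Tate inputs `casselsTate_levelInputs` — the only
extra binder `hCT` —, then Gross–Zagier–Kolyvagin from PUB) followed by the landed kernel; (←) is §1 through the input-free door.
CONDITIONAL on every antecedent; nothing is booked; BSD is not proved by this. [cite: WZhang2014, Thm. 1.1, Thm. 9.1 and §9]
[cite: MilneADT2006, I Thm. 4.10 and Thm. 6.13] [cite: Miller2011LMS, Def. 1.1] -/
theorem levelKolyvaginSystemsAdditive_iff_sharpRankOne (hPub : PublishedInputsAdditiveKoly)
    (hMc : McCallum1991_padicValNat_card_sha_primary_add_le_of_globalDivisibility)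
    (hCT : ∀ (K : Type) [Field K] [NumberField K], casselsTate_levelInputs K)
    (hM : ManinGoodOddFrameAdditive) (h₀ : RankZeroAdditive) :
    LevelKolyvaginSystemsAdditive ↔
      ∀ (W : WeierstrassCurve ℚ) [W.IsElliptic] [W.IsGloballyMinimal] (p : ℕ) [Fact p.Prime],
        ¬ W.HasCM → 5 ≤ p → Addv W p → W.analyticRank = 1 → W.HasSurjectiveModNGaloisRep p →
        (∀ (ℓ : ℕ) [Fact ℓ.Prime], W.HasMultiplicativeReductionAtPrime ℓ →
          ¬ p ∣ padicValInt ℓ W.minimalDiscriminantInt) →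
        (∃ (ℓ₁ ℓ₂ : ℕ) (_ : Fact ℓ₁.Prime) (_ : Fact ℓ₂.Prime), ℓ₁ ≠ ℓ₂ ∧
          W.HasMultiplicativeReductionAtPrime ℓ₁ ∧ W.HasMultiplicativeReductionAtPrime ℓ₂) →
        ¬ p ∣ W.tamagawaProduct → BSDp W p :=
  ⟨fun hKS ↦ AdditiveKolyvaginKernel.additiveKolyvaginKernel_proof hPub hM
      (kolyvaginPrimitiveAdditive_of_casselsTate_of_levelSystems hPub hCT hKS) h₀,
    levelKolyvaginSystemsAdditive_of_rankZeroAdditive_of_sharpRankOne hPub hMc h₀⟩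

end Summit.BirchSwinnertonDyer.BirchSwinnertonDyer.Theorems.AdditiveKoly

end
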